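import Summits.CriticalPhenomena.PercolationContinuityZ3.Theorems.PercNearOneGluingNoHeavyLowerTailIncStarC5MidChord
import HarnessLib

/-!
# The increasing star from ONE above-chord pair per weighted graph (Sahi programme, prover prim-sahi-p2 gen 41)

Support file (`--supports stmt-CriticalPhenomena-4575`, helper).  No definitions, no named facts, no sorries; standard axioms.
Memo `run/shared/lean/prim/prim-sahi/FROM-prim-sahi-p2-gen41-CHORD-AT-B.md`, ADDENDUM F; `prim-sahi-p2/PROOF-E3.md` §51.

By the one-pair chord identity (`IncStar.c5_chord_identity`), `C5(P_w) = (1−p)C5(P⁰) + pC5(P¹) + p(1−p)·IC_e` along ANY pair `e`, so an induction on the number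
of fractional pairs closes as soon as EVERY weighted marked graph with a fractional pair has AT LEAST ONE fractional pair `e` (anywhere in the graph, chosen per graph)
whose chord defect `IC_e` (at the actual weight) is nonnegative:

* `c5_nonneg_of_existsChord` — the C5 family on every finite weighted graph from the hypothesis
  "for every `v` with a fractional pair there is a fractional pair `e` with `IC_e(v) ≥ 0`";
* **`incStar_of_existsChord`**, `incStarPlus_of_existsChord` — hence the increasing star `E₃({s↔a},{s↔b},{s↔c}) ≥ 0` and ISTAR⁺.

STATUS of the hypothesis (CONJECTURE ∃-CHORD of the memo; nothing here asserts it): never violated (law-level censuses, 11.6 M instances; adversarial searches n ≤ 9,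
whose minimum of `max_e IC_e` is `0⁺`; λ-form: the best pair even certifies `2Cov(B_b,B_aB_c) ≥ (16/9)·q_aκ_bc` in every instance tried).  By contrast the
UNIVERSAL forms "every pair at b" (BCL) and "every non-root pair at b" (BCL′) of `…IncStarC5MidChord[NonRoot]` FAIL in thin corners (exact witnesses with
`IC_e ≈ −10⁻¹⁰` on 6–8 vertices, memo ADDENDUM F), so the hypotheses of those files are not satisfiable as stated for `n ≥ 6`; the present file is the
usable reduction.
-/

noncomputable section

namespace Summit.CriticalPhenomena.PercolationContinuityZ3.Theorems

namespace IncStar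

open MeasureTheory Set Literature.Probability.Percolation Literature.Probability.LatticeModels EdgeInduction
open scoped Classical

variable {n : ℕ}

/-- **THE C5 FAMILY FROM ONE ABOVE-CHORD PAIR PER GRAPH.**  Suppose that every weight `v` with a fractional pair admits a fractional pair `e` along which the chord
defect `IC_e(v)` of `c5_chord_identity` (events `{s↔a}, {s↔b}, {s↔c}`, at the actual weight) is nonnegative.  Then `C5(P_w; s; a; b, c) ≥ 0` on every finite
weighted graph and every marking. [this work] -/
theorem c5_nonneg_of_existsChord
    (hEx : ∀ (v : Sym2 (Fin n) → unitInterval) (s a b c : Fin n), (fracEdges v).Nonempty → ∃ e ∈ fracEdges v,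
      let μ := prodBernoulli (Function.update v e 0)
      let ν := prodBernoulli (Function.update v e 1)
      0 ≤ (ν.real (openConn s a) - μ.real (openConn s a)) *
            ((ν.real (openConn s b ∩ openConn s c) - ν.real (openConn s b) * ν.real (openConn s c))
              - (μ.real (openConn s b ∩ openConn s c) - μ.real (openConn s b) * μ.real (openConn s c)))
          + (ν.real (openConn s b) - μ.real (openConn s b)) *
            (2 * (ν.real (openConn s a ∩ openConn s c) - μ.real (openConn s a ∩ openConn s c))
              - (prodBernoulli v).real (openConn s a) * (ν.real (openConn s c) - μ.real (openConn s c)))) :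
    ∀ (w : Sym2 (Fin n) → unitInterval) (s a b c : Fin n),
      let μ := prodBernoulli w
      0 ≤ 2 * μ.real (openConn s a ∩ openConn s b ∩ openConn s c) + μ.real (openConn s a) * μ.real (openConn s b) * μ.real (openConn s c)
            - μ.real (openConn s a) * μ.real (openConn s b ∩ openConn s c) - 2 * (μ.real (openConn s b) * μ.real (openConn s a ∩ openConn s c)) := by
  suffices H : ∀ (k : ℕ) (v : Sym2 (Fin n) → unitInterval), (fracEdges v).card ≤ k → ∀ s a b c : Fin n,
      let μ := prodBernoulli v
      0 ≤ 2 * μ.real (openConn s a ∩ openConn s b ∩ openConn s c) + μ.real (openConn s a) * μ.real (openConn s b) * μ.real (openConn s c)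
            - μ.real (openConn s a) * μ.real (openConn s b ∩ openConn s c) - 2 * (μ.real (openConn s b) * μ.real (openConn s a ∩ openConn s c)) from
    fun w s a b c => H _ w le_rfl s a b c
  intro k
  induction k with
  | zero =>
      intro v hk s a b c
      have hv : ∀ e, v e = 0 ∨ v e = 1 := fun e => eq_zero_or_one_of_not_mem_fracEdges fun he => by
        have : 0 < (fracEdges v).card := Finset.card_pos.2 ⟨e, he⟩
        omega
      simp only
      rw [real_eq_ite_of_zeroOne v hv (openConn s a ∩ openConn s b ∩ openConn s c), real_eq_ite_of_zeroOne v hv (openConn s a),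
        real_eq_ite_of_zeroOne v hv (openConn s b), real_eq_ite_of_zeroOne v hv (openConn s c), real_eq_ite_of_zeroOne v hv (openConn s b ∩ openConn s c),
        real_eq_ite_of_zeroOne v hv (openConn s a ∩ openConn s c)]
      simp only [Set.mem_inter_iff]
      by_cases hA : {e | v e = 1} ∈ openConn s a <;> by_cases hB : {e | v e = 1} ∈ openConn s b <;>
        by_cases hC : {e | v e = 1} ∈ openConn s c <;> norm_num [hA, hB, hC]
  | succ k ih =>
      intro v hk s a b c
      by_cases hne : (fracEdges v).Nonempty
      · obtain ⟨e, he, hIC⟩ := hEx v s a b c hne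
        have h0 := ih (Function.update v e 0) (by have := card_fracEdges_update_lt' v he 0 (Or.inl rfl); omega) s a b c
        have h1 := ih (Function.update v e 1) (by have := card_fracEdges_update_lt' v he 1 (Or.inr rfl); omega) s a b c
        exact c5_nonneg_of_chordStep v e (openConn s a) (openConn s b) (openConn s c) h0 h1 hIC
      · -- no fractional pair: the base case again
        rw [Finset.not_nonempty_iff_eq_empty] at hne
        exact ih v (by rw [hne, Finset.card_empty]; exact Nat.zero_le _) s a b c

/-- **THE INCREASING STAR FROM ONE ABOVE-CHORD PAIR PER GRAPH** (CONJECTURE ∃-CHORD ⟹ ISTAR). [this work] -/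
theorem incStar_of_existsChord
    (hEx : ∀ (v : Sym2 (Fin n) → unitInterval) (s a b c : Fin n), (fracEdges v).Nonempty → ∃ e ∈ fracEdges v,
      let μ := prodBernoulli (Function.update v e 0)
      let ν := prodBernoulli (Function.update v e 1)
      0 ≤ (ν.real (openConn s a) - μ.real (openConn s a)) *
            ((ν.real (openConn s b ∩ openConn s c) - ν.real (openConn s b) * ν.real (openConn s c))
              - (μ.real (openConn s b ∩ openConn s c) - μ.real (openConn s b) * μ.real (openConn s c)))
          + (ν.real (openConn s b) - μ.real (openConn s b)) *
            (2 * (ν.real (openConn s a ∩ openConn s c) - μ.real (openConn s a ∩ openConn s c))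
              - (prodBernoulli v).real (openConn s a) * (ν.real (openConn s c) - μ.real (openConn s c))))
    (w : Sym2 (Fin n) → unitInterval) (s a b c : Fin n) :
    0 ≤ sahiE3 (prodBernoulli w) (openConn s a) (openConn s b) (openConn s c) :=
  sahiE3_nonneg_of_c5 _ _ _ _ (c5_nonneg_of_existsChord hEx w s a b c) (c5_nonneg_of_existsChord hEx w s a c b)

/-- **ISTAR⁺ from one above-chord pair per graph.** [this work] -/
theorem incStarPlus_of_existsChord
    (hEx : ∀ (v : Sym2 (Fin n) → unitInterval) (s a b c : Fin n), (fracEdges v).Nonempty → ∃ e ∈ fracEdges v,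
      let μ := prodBernoulli (Function.update v e 0)
      let ν := prodBernoulli (Function.update v e 1)
      0 ≤ (ν.real (openConn s a) - μ.real (openConn s a)) *
            ((ν.real (openConn s b ∩ openConn s c) - ν.real (openConn s b) * ν.real (openConn s c))
              - (μ.real (openConn s b ∩ openConn s c) - μ.real (openConn s b) * μ.real (openConn s c)))
          + (ν.real (openConn s b) - μ.real (openConn s b)) *
            (2 * (ν.real (openConn s a ∩ openConn s c) - μ.real (openConn s a ∩ openConn s c))
              - (prodBernoulli v).real (openConn s a) * (ν.real (openConn s c) - μ.real (openConn s c))))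
    (w : Sym2 (Fin n) → unitInterval) (s a b c : Fin n) :
    |(prodBernoulli w).real (openConn s b) * (prodBernoulli w).real (openConn s a ∩ openConn s c)
        - (prodBernoulli w).real (openConn s c) * (prodBernoulli w).real (openConn s a ∩ openConn s b)|
      ≤ sahiE3 (prodBernoulli w) (openConn s a) (openConn s b) (openConn s c) :=
  abs_le_sahiE3_of_c5 _ _ _ _ (c5_nonneg_of_existsChord hEx w s a b c) (c5_nonneg_of_existsChord hEx w s a c b)

end IncStar

end Summit.CriticalPhenomena.PercolationContinuityZ3.Theorems
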